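import Summits.Langlands.Langlands.Theorems.IcosahedralSupply.Negative.FalseWithoutPin
import Literature.NumberTheory.GaloisRepresentations.UnramifiedCrystallineRings
import Literature.NumberTheory.GaloisRepresentations.UnramifiedLabelledWeights

/-!
# `IcosahedralSupply` (stmt-Langlands-15899): which clauses of the Fontaine specification are live

Negative-side lemma (crux disprover `cdisprove-stmt-Langlands-15899`, 2026-08-16; supports
stmt-Langlands-15899), sharpening `Negative.FalseWithoutPin`.

`FalseWithoutPin` showed that a proof of the crux uniform in the `p`-adic Hodge datum is impossible
(witness: `ℓ = 1951`, truncated datum `F̂_nr`).  Here the datum family is moreover granted every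
clause of `Literature.NumberTheory.PAdicHodge.IsFontaineDatum` that the truncated datum provably
satisfies — (F1) canonical `ℚ_ℓ`-structure (`LocalField.adicCompletionPadicAlgebra`, by `rfl`),
(F3) `UnramifiedWeightsZero` (`unramifiedPstWeilDeligneData_unramifiedWeightsZero`), (F5)
`HasCrystallineDeformationRings` (`unramifiedPstWeilDeligneData_hasCrystallineDeformationRings`),
(F6) `HasHodgeTypeCrystallineDeformationRings`
(`unramifiedPstWeilDeligneData_hasHodgeTypeCrystallineDeformationRings`) and (F8) the Frobenius
normalisation `WD ≅ (ρ|_{W_F}, N = 0)` on unramified `ρ` (the truncated datum's relation IS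
`N = 0 ∧ r.ρ ≅ ρ|_{W_F}`) — and the statement is STILL false
(`icosahedralSupply_false_without_cyclotomic_clauses`).  Reading: under `FontaineDatumExists`, any
proof of `IcosahedralSupply` as typed must extract the de Rham-ness at `ℓ = 1951` of a RAMIFIED
finite-image representation from the remaining clauses (F2) `CyclotomicWeightNegOne`, (F4)
`IsCrystallineFramed χ_cyc` or (F7) `CrystallineGenericFibreRegular` — two statements about the
(infinitely ramified) cyclotomic character and one about regularity of generic fibres of the datum's
own crystalline deformation rings; none mentions a potentially unramified representation.  This is
the precise residual content of the `ℓ = 1951` stub; the recommended repair remains `ℓ ≠ 1951` in the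
crux (the deciding theorem uses `ℓ = 17`) or a clause (F9) "potentially unramified ⇒ de Rham".
-/

noncomputable section

set_option linter.dupNamespace false -- `Summit.Langlands.Langlands` is the mandated namespace (D-0017)

open scoped NumberField
open Field IsDedekindDomain

namespace Summit.Langlands.Langlands.Theorems.IcosahedralSupply.Negative

open Literature.NumberTheory.GaloisRepresentations Literature.NumberTheory.PAdicHodge

/-- **(F8) for the truncated datum.**  For `F̂_nr` the relation `IsWeilDeligneOf ρ r` is
`r.N = 0 ∧ r.ρ ≅ ρ|_{W_F}`, so every Weil–Deligne representation it attaches to an unramified `ρ`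
is isomorphic to `(ρ|_{W_F}, N = 0)`: clause (F8) of `IsFontaineDatum` holds for it. [folklore] -/
theorem unramifiedPstWeilDeligneData_clauseF8 {F : Type} [Field F] [ValuativeRel F]
    [TopologicalSpace F] [IsNonarchimedeanLocalField F] {ℓ : ℕ} [Fact ℓ.Prime] [Algebra ℚ_[ℓ] F]
    {n : ℕ} (ρ : FramedRep (absoluteGaloisGroup F) (PadicAlgCl ℓ) n)
    (r : WeilDeligneRep F (PadicAlgCl ℓ) (Fin n → PadicAlgCl ℓ)) (hρ : ρ.IsLocallyUnramified)
    (hr : (unramifiedPstWeilDeligneData F ℓ).IsWeilDeligneOf ρ r) :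
    r.IsEquivalent
      (WeilDeligneRep.ofRep (ρ.weilRestrict F) hρ.isUnramifiedRep_weilRestrict.isContinuousRep) := by
  obtain ⟨hN, ⟨e⟩⟩ := (unramifiedPstWeilDeligneData_isWeilDeligneOf_iff ρ r).1 hr
  exact ⟨{ toRepEquiv := e
           comm_N := by rw [hN, WeilDeligneRep.ofRep_N, LinearMap.comp_zero, LinearMap.zero_comp] }⟩

/-- **The live clauses are (F2), (F4), (F7).**  `IcosahedralSupply` with the pinned datum replaced
by an arbitrary datum family `pst ℓ v hv` that satisfies clauses (F1), (F3), (F5), (F6), (F8) of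
`IsFontaineDatum` at every `v ∣ ℓ` is FALSE: the truncated family
`unramifiedPstWeilDeligneData (ℚ_v) ℓ` on the canonical `ℚ_ℓ`-structure meets all five clauses and,
at `ℓ = 1951`, rejects every `ρ` the crux asks for (`icosahedralSupply_false_without_pin`'s
argument: de Rham for `F̂_nr` ⇔ unramified, but conductor `1951` forces ramification above `1951`).
Hence, under `FontaineDatumExists`, a proof of the crux as typed must use (F2), (F4) or (F7) to get
de Rham-ness of a ramified finite-image representation at `ℓ = 1951`. [folklore] -/
theorem icosahedralSupply_false_without_cyclotomic_clauses :
    ¬ ∀ (pst : ∀ (ℓ : ℕ) [Fact ℓ.Prime] (v : HeightOneSpectrum (𝓞 ℚ)),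
          ((ℓ : ℕ) : 𝓞 ℚ) ∈ v.asIdeal → PstWeilDeligneData (v.adicCompletion ℚ) ℓ),
      (∀ (ℓ : ℕ) [Fact ℓ.Prime] (v : HeightOneSpectrum (𝓞 ℚ)) (hv : ((ℓ : ℕ) : 𝓞 ℚ) ∈ v.asIdeal),
        (pst ℓ v hv).algebra = LocalField.adicCompletionPadicAlgebra v ℓ hv ∧
        (pst ℓ v hv).UnramifiedWeightsZero ∧
        (pst ℓ v hv).HasCrystallineDeformationRings ∧
        (pst ℓ v hv).HasHodgeTypeCrystallineDeformationRings ∧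
        ∀ {n : ℕ} (ρ : FramedRep (absoluteGaloisGroup (v.adicCompletion ℚ)) (PadicAlgCl ℓ) n)
          (r : WeilDeligneRep (v.adicCompletion ℚ) (PadicAlgCl ℓ) (Fin n → PadicAlgCl ℓ))
          (hρ : ρ.IsLocallyUnramified), (pst ℓ v hv).IsWeilDeligneOf ρ r →
            r.IsEquivalent (WeilDeligneRep.ofRep (ρ.weilRestrict (v.adicCompletion ℚ))
              hρ.isUnramifiedRep_weilRestrict.isContinuousRep)) →
      ∀ (ℓ : ℕ) [Fact ℓ.Prime], 17 ≤ ℓ →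
        ∃ (ι : PadicAlgCl ℓ ≃+* ℂ) (ρ : FramedGaloisRep ℚ (PadicAlgCl ℓ) 2),
          ((∀ᶠ v : HeightOneSpectrum (𝓞 ℚ) in Filter.cofinite, ρ.IsUnramifiedAt v) ∧
            ∀ (v : HeightOneSpectrum (𝓞 ℚ)) (hv : ((ℓ : ℕ) : 𝓞 ℚ) ∈ v.asIdeal),
              (pst ℓ v hv).IsDeRhamFramed (ρ.toLocal v)) ∧
          (ρ.toGaloisRep.IsIrreducible ∧ (Set.range ρ).Finite ∧ ρ.IsEven ∧
            ρ.toGaloisRep.artinConductorNat = 1951 ∧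
            ∃ χ₀ : DirichletCharacter ℂ 1951, orderOf χ₀ = 5 ∧
              ∀ v : HeightOneSpectrum (𝓞 ℚ), v.residueCard ≠ 1951 →
                ρ.IsUnramifiedAt v ∧ ∃ t d : PadicAlgCl ℓ,
                  ρ.HasFrobCharpolyAt v
                    (Polynomial.X ^ 2 - Polynomial.C t * Polynomial.X + Polynomial.C d) ∧
                  ι d = (χ₀ (v.residueCard : ZMod 1951))⁻¹ ∧
                  (t ^ 2 = 0 ∨ t ^ 2 = d ∨ t ^ 2 = 4 * d ∨
                    t ^ 4 - 3 * d * t ^ 2 + d ^ 2 = 0)) := by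
  intro h
  haveI : Fact (Nat.Prime 1951) := ⟨prime_1951_and_le.1⟩
  obtain ⟨w, hw⟩ := exists_natCast_1951_mem
  -- the truncated family on the canonical `ℚ_ℓ`-structure, and its five clauses
  have hcl := h (fun ℓ _ v hv =>
      @unramifiedPstWeilDeligneData (v.adicCompletion ℚ) _ _ _ _ ℓ _
        (LocalField.adicCompletionPadicAlgebra v ℓ hv))
    (fun ℓ _ v hv => by
      letI := LocalField.adicCompletionPadicAlgebra v ℓ hv
      exact ⟨rfl, unramifiedPstWeilDeligneData_unramifiedWeightsZero,
        unramifiedPstWeilDeligneData_hasCrystallineDeformationRings _ _,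
        unramifiedPstWeilDeligneData_hasHodgeTypeCrystallineDeformationRings _ _,
        fun ρ r hρ hr => unramifiedPstWeilDeligneData_clauseF8 ρ r hρ hr⟩)
    1951 prime_1951_and_le.2
  obtain ⟨ι, ρ, ⟨-, hdR⟩, -, -, -, hN, χ₀, -, hv⟩ := hcl
  have hloc : (ρ.toLocal w).IsLocallyUnramified :=
    (@unramifiedPstWeilDeligneData_isDeRhamFramed_iff (w.adicCompletion ℚ) _ _ _ _ 1951 _
      (LocalField.adicCompletionPadicAlgebra w 1951 hw) 2 (ρ.toLocal w)).1 (hdR w hw)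
  exact not_isUnramifiedAt_of_artinConductorNat ρ hN (fun v hv' => (hv v hv').1) hw
    (isUnramifiedAt_of_isLocallyUnramified_toLocal ρ w hloc)

end Summit.Langlands.Langlands.Theorems.IcosahedralSupply.Negative

end
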